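/-
Copyright (c) 2026 the pub-hodgecm-mathlib formalisation cell (harness21).  Prover seat hodgecm-mathlib-F0P3a-p08 (g21): road «S3-ram» (LEAD F0P3a-plan (g13);
owner ∕ (α) keeper F0P3a-p06 (g16); (Cnt2′) chair F0P3a-p07 (g15) RULING (13)(6): `stub_Zhyp` composition pen), organ «(K5-B-J) KIND COUNTS OF THE HYPERBOLIC ROOT
REGION IN JUNCTION CURRENCY», FILE 1 (generic `K`): the kind-keyed root region of the block literal, read on the `W`-block; 2026-09-02.
-/
import Literature.NumberTheory.Automorphic.UnitaryLatticeTreeBlockRootRegionAxis   -- ★ p849125 (F0P3a-p01 (g18)): THM 1 `single_one_one_mem_of_selfDual_lev_of_lt_v_det`; brings ★ (z1-d) `ncard_selfDual_fixed_axis_eq`, ★ (z1-a∕b) axis dictionary (`mem_latt_endoGL_one_iff`, `pairing_endoShape_apply`, `map_endoGL_sub_one_latt_endoGL_le_scaleLattice_iff`), `antidiagonal_three_over_eq_endoShape`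
import HarnessLib

/-!
# The lattice graph of a hermitian space — the root region of the block literal `ι(B₀, 1)` KEYED BY THE CENTRED KIND TOKENS (inner ∕ shell-class ∕ shell-not-class),
# counted on the `W`-side (Bruhat–Tits 1972 §10; Kottwitz 1986 §3; Rogawski 1990 §4.9)

Topic `NumberTheory/Automorphic`; namespace `Literature.NumberTheory.Automorphic.UnitaryLatticeTree`.  THEOREMS ONLY (no definition, no instance, no notation, no named fact,
no `sorry`); kernel lane `--supports stmt-HodgeConjecture-24833`; datum-free (`K` with `Valued K ℤᵐ⁰`, `σ` any valuation-preserving involution).  Cell `pub/hodgecm-mathlib`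
(D-0151), crux H413; road «S3-ram» (count-neutral); the (Cnt2′) BLOCK-LAW skeleton (keeper F0P3a-p06 (g16), chair F0P3a-p07 (g15) RULING (13)), hyperbolic cells
`stub_Zhyp_{zero,pm}_{even,odd}_B` (REGIME B: root level `d₀ = m < N`).  Their pooled census ((4a) ★ `regionCensus_block_of_kindCounts`, F0P3-p03 (g16)) needs, besides the
per-kind VALUES ((K4a) ★ `blockVertexCensus_{shell,inner}`, A-p12 (g25); (K4b) their `∀ v ∈ R`-form keyed on the centred kind tokens below), the KIND MULTIPLICITIES over the
root region `R = {v ∣ γ·v = v ∧ SD v.1 ∧ (γ − 1)·v.1 ≤ ϖ^{d₀}·v.1}` (the raw junction head's `hsR` set) of the CENTRED hyperbolic literal `γ = ι(B₀, 1)`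
(`B₀ = k⁻¹·(s·ĝ_w)·k`, ★ A-p19 (g29) (h1) FILES 1–4).  With `cB := ½·tr B₀` and the lock datum `t₀ := (ϖ^{d₀})⁻¹·(cB − 1)` (a unit in regime B) the kinds are A-p12's
(05:07:10Z) tokens, read on vectors `y ∈ v.1` with `y₁ = 0` (the `W`-part of the axis vertex):
* INNER `Pin v :⟺ ∀ y ∈ v.1, y₁ = 0 → (γ − cB·1)·y ∈ ϖ^{d₀+1}·v.1` (the centred `W`-block is deeper than `d₀` on the vertex);
* BIG `Qbig v :⟺ ∃ y ∈ v.1, y₁ = 0 ∧ ∃ a ∈ 𝒪^×, |(ϖ^{d₀})⁻¹·⟨y, (γ − cB·1)y⟩_{Φ₃} − t₀·a²| < 1` (the centred rank-one class of the vertex against `t₀`).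
THIS FILE (generic): every region vertex is an AXIS vertex `latt ι(g₂, 1)` (★ THM 4 `single_one_one_mem_of_mem_rootRegion_of_coe_eq_endoGL`, regime-B premise
`|det(B₀ − 1)| > |ϖ|^{2d₀+1}`), on which both centred tokens are the corresponding CENTRED `W`-tokens of `latt g₂` for `B₀` EXACTLY (§1: the middle coordinate vanishes,
no approximation), so ★ (z1-d) `ncard_selfDual_fixed_axis_eq` moves the three kind counts to the `W`-block:
* **`ncard_rootRegion_inner_eq_ncard_two`** — `#{v ∣ v ∈ R ∧ Pin v} = #{B ∣ SD_{Φ₂} B ∧ B₀B = B ∧ ((B₀ − 1)B ≤ ϖ^{d₀}B ∧ (B₀ − cB·1)B ≤ ϖ^{d₀+1}B)}`;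
* **`ncard_rootRegion_shell_class_eq_ncard_two`** — `#{v ∣ v ∈ R ∧ ¬Pin v ∧ Qbig v} = #{B ∣ … ∧ ((B₀ − 1)B ≤ ϖ^{d₀}B ∧ ¬(B₀ − cB·1)B ≤ ϖ^{d₀+1}B ∧ CLS^{c,W}_{d₀}(t₀)(B))}`;
* **`ncard_rootRegion_shell_not_class_eq_ncard_two`** — the same with `¬CLS^{c,W}`.
(`Φ₂ = !![0, 1; 1, 0]`; FILE 2 (CM, `Rogawski1990/…HyperbolicRegionKinds`) transports the right-hand sides along `B ↦ k·B` to p05 (g18)'s ★ centred balls ∕ centred-shell halves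
of `s·ĝ_w` and evaluates them.)  Mechanism and texts follow p05's ★ (T) `UnitaryLatticeTreeBlockRootRegionAxisTopClass` (regime A-even) with THM 1's det-premise in place of
the top-ness premise and the centred tokens of §1 in place of ★ `exists_class_latt_endoGL_one_iff`.
HONEST LABEL: HC_CM is proved only modulo the 2 remaining named inputs (hLiu418 24832, h413 24833) until rung 0 closes; nothing printed is asserted here (elementary lattice
bookkeeping over ★ results); «S3-ram» has no books consequence.

## References
* [BruhatTits1972] F. Bruhat, J. Tits, *Groupes réductifs sur un corps local I*, Publ. Math. IHÉS 41 (1972), §10 (lattice models of the building).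
* [Kottwitz1986] R. E. Kottwitz, *Base change for unit elements of Hecke algebras*, Compositio Math. 60 (1986), §3 (counting fixed lattices).
* [Rogawski1990] J. D. Rogawski, *Automorphic Representations of Unitary Groups in Three Variables*, Ann. of Math. Stud. 123 (1990), §4.8 Case (a) p. 53, §4.9 pp. 54–56.
* [LabesseLanglands1979] J.-P. Labesse, R. P. Langlands, *L-indistinguishability for SL(2)*, Canad. J. Math. 31 (1979), §2 Lemma 2.1 p. 8.
-/

set_option autoImplicit false

noncomputable section

open scoped Valued WithZero Matrix MatrixGroups

namespace Literature.NumberTheory.Automorphic.UnitaryLatticeTree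

open Literature.NumberTheory.Automorphic Literature.NumberTheory.Automorphic.HermitianLattice Literature.NumberTheory.Rogawski1990

variable {K : Type*} [Field K] [Valued K ℤᵐ⁰]

/-! ## §1 The centred tokens of an axis vertex are the centred tokens of its `W`-block -/

omit [Valued K ℤᵐ⁰] in
/-- `(ι(a, b) − c·1)·y = ((a − c·1)·(y₀, y₂) on W, (b₀₀ − c)·y₁ on e₁)`. [cite: Rogawski1990, §4.8 Case (a) p. 53] -/
theorem coe_endoGL_sub_smul_one_mulVec_apply (a : GL (Fin 2) K) (b : GL (Fin 1) K) (c : K) (y : Fin 3 → K) :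
    ((((endoGL (a, b) : GL (Fin 3) K) : Matrix (Fin 3) (Fin 3) K) - c • (1 : Matrix (Fin 3) (Fin 3) K)) *ᵥ y) =
      ![(((a : Matrix (Fin 2) (Fin 2) K) - c • (1 : Matrix (Fin 2) (Fin 2) K)) *ᵥ ![y 0, y 2]) 0, ((b : Matrix (Fin 1) (Fin 1) K) 0 0 - c) * y 1,
        (((a : Matrix (Fin 2) (Fin 2) K) - c • (1 : Matrix (Fin 2) (Fin 2) K)) *ᵥ ![y 0, y 2]) 1] := by
  rw [coe_endoGL_eq_endoShape]
  ext i
  fin_cases i <;> simp [Matrix.mulVec, dotProduct, Fin.sum_univ_three, Fin.sum_univ_two, Matrix.one_apply, sub_mul]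

/-- **THE CENTRED LEVEL TOKEN ON THE `W`-PART OF AN AXIS VERTEX IS THE CENTRED LEVEL TOKEN OF ITS `W`-BLOCK** (`e ≠ 0`, any centre `c`, any block element `ι(γ₂, u)`):
`(∀ y ∈ latt ι(g₂,1), y₁ = 0 → (ι(γ₂,u) − c·1)·y ∈ e·latt ι(g₂,1)) ⟺ (γ₂ − c·1)·latt g₂ ⊆ e·latt g₂`. [cite: BruhatTits1972, §10] [cite: Kottwitz1986, §3] -/
theorem forall_centred_mulVec_mem_scaleLattice_latt_endoGL_one_iff {e : K} (he : e ≠ 0) (g₂ γ₂ : GL (Fin 2) K) (u : GL (Fin 1) K) (c : K) :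
    (∀ y ∈ latt ((endoGL (g₂, (1 : GL (Fin 1) K)) : GL (Fin 3) K) : Matrix (Fin 3) (Fin 3) K), y 1 = 0 →
        ((((endoGL (γ₂, u) : GL (Fin 3) K) : Matrix (Fin 3) (Fin 3) K) - c • (1 : Matrix (Fin 3) (Fin 3) K)) *ᵥ y) ∈
          scaleLattice e (latt ((endoGL (g₂, (1 : GL (Fin 1) K)) : GL (Fin 3) K) : Matrix (Fin 3) (Fin 3) K))) ↔
      (latt (g₂ : Matrix (Fin 2) (Fin 2) K)).map ((Matrix.toLin' ((γ₂ : Matrix (Fin 2) (Fin 2) K) - c • (1 : Matrix (Fin 2) (Fin 2) K))).restrictScalars 𝒪[K]) ≤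
        scaleLattice e (latt (g₂ : Matrix (Fin 2) (Fin 2) K)) := by
  constructor
  · intro h
    rw [Submodule.map_le_iff_le_comap]
    intro z hz
    rw [Submodule.mem_comap, LinearMap.restrictScalars_apply, Matrix.toLin'_apply]
    have e3 : (![(![z 0, 0, z 1] : Fin 3 → K) 0, (![z 0, 0, z 1] : Fin 3 → K) 2] : Fin 2 → K) = z := by ext i; fin_cases i <;> simp
    have hy : (![z 0, 0, z 1] : Fin 3 → K) ∈ latt ((endoGL (g₂, (1 : GL (Fin 1) K)) : GL (Fin 3) K) : Matrix (Fin 3) (Fin 3) K) := by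
      rw [mem_latt_endoGL_one_iff, e3]; exact ⟨hz, by simp⟩
    have hw := h _ hy (by simp)
    rw [coe_endoGL_sub_smul_one_mulVec_apply, mem_scaleLattice_iff he, mem_latt_endoGL_one_iff, e3] at hw
    obtain ⟨hw, -⟩ := hw
    rw [mem_scaleLattice_iff he]
    convert hw using 1
    ext i; fin_cases i <;> simp
  · intro h y hy hy1
    obtain ⟨hyW, -⟩ := (mem_latt_endoGL_one_iff g₂ y).1 hy
    have hz := forall_mulVec_mem_scaleLattice_of_map_le _ _ _ h _ hyW
    rw [mem_scaleLattice_iff he] at hz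
    rw [coe_endoGL_sub_smul_one_mulVec_apply, hy1, mul_zero, mem_scaleLattice_iff he, mem_latt_endoGL_one_iff]
    refine ⟨?_, by simp⟩
    convert hz using 1
    ext i; fin_cases i <;> simp

omit [Valued K ℤᵐ⁰] in
/-- On a vector with `y₁ = 0` the value `⟨y, (ι(γ₂,u) − c·1)y⟩` of a block form is the `W`-value `⟨(y₀,y₂), (γ₂ − c·1)(y₀,y₂)⟩_{H₂}` EXACTLY. [cite: Rogawski1990, §4.8 Case (a) p. 53] -/
theorem pairing_endoShape_centred_mulVec_of_apply_one_eq_zero (σ : K →+* K) (H₂ : Matrix (Fin 2) (Fin 2) K) (h : K) (γ₂ : GL (Fin 2) K) (u : GL (Fin 1) K) (c : K)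
    (y : Fin 3 → K) (hy1 : y 1 = 0) :
    pairing σ (!![H₂ 0 0, 0, H₂ 0 1; 0, h, 0; H₂ 1 0, 0, H₂ 1 1] : Matrix (Fin 3) (Fin 3) K) y
        ((((endoGL (γ₂, u) : GL (Fin 3) K) : Matrix (Fin 3) (Fin 3) K) - c • (1 : Matrix (Fin 3) (Fin 3) K)) *ᵥ y) =
      pairing σ H₂ ![y 0, y 2] ((((γ₂ : Matrix (Fin 2) (Fin 2) K)) - c • (1 : Matrix (Fin 2) (Fin 2) K)) *ᵥ ![y 0, y 2]) := by
  rw [coe_endoGL_sub_smul_one_mulVec_apply, pairing_endoShape_apply, hy1, map_zero, zero_mul, zero_mul, add_zero]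
  congr 1
  ext i; fin_cases i <;> simp

/-- **THE CENTRED RANK-ONE CLASS TOKEN ON THE `W`-PART OF AN AXIS VERTEX IS THAT OF ITS `W`-BLOCK** (any scale `r`, centre `c`, constant `t`; no approximation needed since
the middle coordinate is `0`). [cite: Kottwitz1986, §3] [cite: BruhatTits1972, §10] [cite: LabesseLanglands1979, §2 Lemma 2.1 p. 8] -/
theorem exists_centred_class_latt_endoGL_one_iff (σ : K →+* K) (H₂ : Matrix (Fin 2) (Fin 2) K) (h : K) (g₂ γ₂ : GL (Fin 2) K) (u : GL (Fin 1) K) (c r t : K) :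
    (∃ y ∈ latt ((endoGL (g₂, (1 : GL (Fin 1) K)) : GL (Fin 3) K) : Matrix (Fin 3) (Fin 3) K), y 1 = 0 ∧ ∃ a : K, Valued.v a = 1 ∧
        Valued.v (r * pairing σ (!![H₂ 0 0, 0, H₂ 0 1; 0, h, 0; H₂ 1 0, 0, H₂ 1 1] : Matrix (Fin 3) (Fin 3) K) y
          ((((endoGL (γ₂, u) : GL (Fin 3) K) : Matrix (Fin 3) (Fin 3) K) - c • (1 : Matrix (Fin 3) (Fin 3) K)) *ᵥ y) - t * a ^ 2) < 1) ↔
      (∃ y₂ ∈ latt (g₂ : Matrix (Fin 2) (Fin 2) K), ∃ a : K, Valued.v a = 1 ∧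
        Valued.v (r * pairing σ H₂ y₂ ((((γ₂ : Matrix (Fin 2) (Fin 2) K)) - c • (1 : Matrix (Fin 2) (Fin 2) K)) *ᵥ y₂) - t * a ^ 2) < 1) := by
  constructor
  · rintro ⟨y, hy, hy1, a, ha, hcl⟩
    obtain ⟨hyW, -⟩ := (mem_latt_endoGL_one_iff g₂ y).1 hy
    refine ⟨![y 0, y 2], hyW, a, ha, ?_⟩
    rwa [pairing_endoShape_centred_mulVec_of_apply_one_eq_zero σ H₂ h γ₂ u c y hy1] at hcl
  · rintro ⟨y₂, hy₂, a, ha, hcl⟩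
    have e : (![(![y₂ 0, 0, y₂ 1] : Fin 3 → K) 0, (![y₂ 0, 0, y₂ 1] : Fin 3 → K) 2] : Fin 2 → K) = y₂ := by ext i; fin_cases i <;> simp
    refine ⟨![y₂ 0, 0, y₂ 1], (mem_latt_endoGL_one_iff g₂ _).2 ⟨by rw [e]; exact hy₂, by simp⟩, by simp, a, ha, ?_⟩
    rw [pairing_endoShape_centred_mulVec_of_apply_one_eq_zero σ H₂ h γ₂ u c _ (by simp), e]
    exact hcl

/-! ## §2 The kind-keyed root region of `ι(B₀, 1)`, counted on the `W`-side -/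

set_option maxHeartbeats 1600000 in -- budget only: statement-heavy lattice tokens.
/-- **THE INNER KIND OF THE ROOT REGION, COUNTED ON THE `W`-SIDE.**  For `γ ∈ U(σ, Φ₃)` with matrix `ι(B₀, 1)` and `|det(B₀ − 1)| > |ϖ|^{2d₀+1}` (regime B of the
hyperbolic literal: `d₀ = m`, ★ A-p19 `v_det_rerootedCentred_sub_one_eq_ram`), `cB = ½tr B₀`:
`#{v ∣ v ∈ R ∧ Pin v} = #{B ∣ SD_{Φ₂} B ∧ B₀B = B ∧ ((B₀ − 1)B ≤ ϖ^{d₀}B ∧ (B₀ − cB·1)B ≤ ϖ^{d₀+1}B)}` (the centred `W`-ball one step inside the region).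
[cite: Kottwitz1986, §3] [cite: BruhatTits1972, §10] [cite: Rogawski1990, §4.9 pp. 54–56] -/
theorem ncard_rootRegion_inner_eq_ncard_two [IsPrincipalIdealRing 𝒪[K]] {σ : K →+* K} {ϖ : K}
    (hσ : ∀ a, σ (σ a) = a) (hvσ : ∀ a, Valued.v (σ a) = Valued.v a) (hϖ : Valued.v ϖ = WithZero.exp (-1 : ℤ))
    (γ : unitaryGroupOfForm σ ((StdForm.antidiagonal 3).over K)) (B₀ : GL (Fin 2) K) (hγ : (γ : GL (Fin 3) K) = endoGL (B₀, (1 : GL (Fin 1) K))) {d₀ : ℕ}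
    (hdet : Valued.v ϖ ^ (2 * d₀ + 1) < Valued.v (((B₀ : Matrix (Fin 2) (Fin 2) K) - (1 : Matrix (Fin 2) (Fin 2) K)).det)) :
    {v : {M : Submodule 𝒪[K] (Fin 3 → K) // IsVertex σ ϖ ((StdForm.antidiagonal 3).over K) M} | v ∈ {v : {M : Submodule 𝒪[K] (Fin 3 → K) // IsVertex σ ϖ ((StdForm.antidiagonal 3).over K) M} | latticeGraphIso σ ϖ ((StdForm.antidiagonal 3).over K) γ v = v ∧ IsSelfDualLattice σ ϖ ((StdForm.antidiagonal 3).over K) v.1 ∧ v.1.map ((Matrix.toLin' (((γ : GL (Fin 3) K) : Matrix (Fin 3) (Fin 3) K) - 1)).restrictScalars 𝒪[K]) ≤ scaleLattice (ϖ ^ d₀) v.1} ∧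
        ∀ y ∈ v.1, y 1 = 0 → ((((γ : GL (Fin 3) K) : Matrix (Fin 3) (Fin 3) K) - ((B₀ : Matrix (Fin 2) (Fin 2) K).trace / 2) • (1 : Matrix (Fin 3) (Fin 3) K)) *ᵥ y) ∈ scaleLattice (ϖ ^ (d₀ + 1)) v.1}.ncard =
    {B : Submodule 𝒪[K] (Fin 2 → K) | IsSelfDualLattice σ ϖ (!![(0 : K), 1; 1, 0] : Matrix (Fin 2) (Fin 2) K) B ∧ mapGL B₀ B = B ∧
        (B.map ((Matrix.toLin' ((B₀ : Matrix (Fin 2) (Fin 2) K) - 1)).restrictScalars 𝒪[K]) ≤ scaleLattice (ϖ ^ d₀) B ∧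
          B.map ((Matrix.toLin' ((B₀ : Matrix (Fin 2) (Fin 2) K) - ((B₀ : Matrix (Fin 2) (Fin 2) K).trace / 2) • (1 : Matrix (Fin 2) (Fin 2) K))).restrictScalars 𝒪[K]) ≤
            scaleLattice (ϖ ^ (d₀ + 1)) B)}.ncard := by
  have hϖ0' : Valued.v ϖ ≠ 0 := by rw [hϖ]; exact WithZero.exp_ne_zero
  have hϖ0 : ϖ ≠ 0 := fun h0 => by rw [h0, map_zero] at hϖ0'; exact hϖ0' rfl
  have hϖ1 : Valued.v ϖ ≤ 1 := by rw [hϖ, ← WithZero.exp_zero]; exact WithZero.exp_le_exp.2 (by norm_num)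
  have hH₂ : IsUnit (!![(0 : K), 1; 1, 0] : Matrix (Fin 2) (Fin 2) K).det := by
    rw [Matrix.det_fin_two]; simp
  have hu : Valued.v (((1 : GL (Fin 1) K) : Matrix (Fin 1) (Fin 1) K) 0 0) = 1 := by rw [Units.val_one, Matrix.one_apply_eq, map_one]
  have hud : Valued.v (((1 : GL (Fin 1) K) : Matrix (Fin 1) (Fin 1) K) 0 0 - 1) ≤ Valued.v (ϖ ^ d₀) := by
    rw [Units.val_one, Matrix.one_apply_eq, sub_self, map_zero]; exact zero_le
  have hdet' : Valued.v ϖ ^ (2 * d₀ + 1) <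
      Valued.v (((B₀ : Matrix (Fin 2) (Fin 2) K) - ((1 : GL (Fin 1) K) : Matrix (Fin 1) (Fin 1) K) 0 0 • (1 : Matrix (Fin 2) (Fin 2) K)).det) := by
    rw [Units.val_one, Matrix.one_apply_eq, one_smul]; exact hdet
  -- the vertex set is the copy of the rank-3 lattice set under `v ↦ v.1`, and every member is an axis vertex (★ THM 4)
  have himg : (Subtype.val '' {v : {M : Submodule 𝒪[K] (Fin 3 → K) // IsVertex σ ϖ ((StdForm.antidiagonal 3).over K) M} | v ∈ {v : {M : Submodule 𝒪[K] (Fin 3 → K) // IsVertex σ ϖ ((StdForm.antidiagonal 3).over K) M} | latticeGraphIso σ ϖ ((StdForm.antidiagonal 3).over K) γ v = v ∧ IsSelfDualLattice σ ϖ ((StdForm.antidiagonal 3).over K) v.1 ∧ v.1.map ((Matrix.toLin' (((γ : GL (Fin 3) K) : Matrix (Fin 3) (Fin 3) K) - 1)).restrictScalars 𝒪[K]) ≤ scaleLattice (ϖ ^ d₀) v.1} ∧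
        ∀ y ∈ v.1, y 1 = 0 → ((((γ : GL (Fin 3) K) : Matrix (Fin 3) (Fin 3) K) - ((B₀ : Matrix (Fin 2) (Fin 2) K).trace / 2) • (1 : Matrix (Fin 3) (Fin 3) K)) *ᵥ y) ∈ scaleLattice (ϖ ^ (d₀ + 1)) v.1}) =
      {M : Submodule 𝒪[K] (Fin 3 → K) | IsSelfDualLattice σ ϖ (!![((!![(0 : K), 1; 1, 0] : Matrix (Fin 2) (Fin 2) K)) 0 0, 0, ((!![(0 : K), 1; 1, 0] : Matrix (Fin 2) (Fin 2) K)) 0 1; 0, (1 : K), 0; ((!![(0 : K), 1; 1, 0] : Matrix (Fin 2) (Fin 2) K)) 1 0, 0, ((!![(0 : K), 1; 1, 0] : Matrix (Fin 2) (Fin 2) K)) 1 1] : Matrix (Fin 3) (Fin 3) K) M ∧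
        mapGL (endoGL (B₀, (1 : GL (Fin 1) K))) M = M ∧ (Pi.single 1 1 : Fin 3 → K) ∈ M ∧ (M.map ((Matrix.toLin' (((endoGL (B₀, (1 : GL (Fin 1) K)) : GL (Fin 3) K) : Matrix (Fin 3) (Fin 3) K) - 1)).restrictScalars 𝒪[K]) ≤ scaleLattice (ϖ ^ d₀) M ∧
          ∀ y ∈ M, y 1 = 0 → ((((endoGL (B₀, (1 : GL (Fin 1) K)) : GL (Fin 3) K) : Matrix (Fin 3) (Fin 3) K) - ((B₀ : Matrix (Fin 2) (Fin 2) K).trace / 2) • (1 : Matrix (Fin 3) (Fin 3) K)) *ᵥ y) ∈ scaleLattice (ϖ ^ (d₀ + 1)) M)} := by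
    ext M
    simp only [Set.mem_image, Set.mem_setOf_eq]
    constructor
    · rintro ⟨v, ⟨⟨hfix, hSD, hlev⟩, hkind⟩, rfl⟩
      have e := congrArg Subtype.val hfix
      rw [latticeGraphIso_apply_coe, hγ] at e
      have hSD' : IsSelfDualLattice σ ϖ (!![((!![(0 : K), 1; 1, 0] : Matrix (Fin 2) (Fin 2) K)) 0 0, 0, ((!![(0 : K), 1; 1, 0] : Matrix (Fin 2) (Fin 2) K)) 0 1; 0, (1 : K), 0; ((!![(0 : K), 1; 1, 0] : Matrix (Fin 2) (Fin 2) K)) 1 0, 0, ((!![(0 : K), 1; 1, 0] : Matrix (Fin 2) (Fin 2) K)) 1 1] : Matrix (Fin 3) (Fin 3) K) v.1 := by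
        rw [← antidiagonal_three_over_eq_endoShape]; exact hSD
      have hax := single_one_one_mem_of_mem_rootRegion_of_coe_eq_endoGL hσ hvσ hϖ γ B₀ (1 : GL (Fin 1) K) hγ hdet' v ⟨hfix, hSD, hlev⟩
      rw [hγ] at hlev hkind
      exact ⟨hSD', e, hax, hlev, hkind⟩
    · rintro ⟨hSD, hfix, -, hlev, hkind⟩
      rw [← antidiagonal_three_over_eq_endoShape] at hSD
      refine ⟨⟨M, 0, hSD⟩, ⟨⟨?_, hSD, ?_⟩, ?_⟩, rfl⟩
      · apply Subtype.ext
        rw [latticeGraphIso_apply_coe, hγ]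
        exact hfix
      · rw [hγ]; exact hlev
      · rw [hγ]; exact hkind
  rw [← Set.ncard_image_of_injective _ Subtype.val_injective, himg]
  refine ncard_selfDual_fixed_axis_eq σ hvσ hϖ0 hϖ1 hH₂ (h := (1 : K)) (by rw [map_one]) B₀ hu
    (fun M => M.map ((Matrix.toLin' (((endoGL (B₀, (1 : GL (Fin 1) K)) : GL (Fin 3) K) : Matrix (Fin 3) (Fin 3) K) - 1)).restrictScalars 𝒪[K]) ≤ scaleLattice (ϖ ^ d₀) M ∧
      ∀ y ∈ M, y 1 = 0 → ((((endoGL (B₀, (1 : GL (Fin 1) K)) : GL (Fin 3) K) : Matrix (Fin 3) (Fin 3) K) - ((B₀ : Matrix (Fin 2) (Fin 2) K).trace / 2) • (1 : Matrix (Fin 3) (Fin 3) K)) *ᵥ y) ∈ scaleLattice (ϖ ^ (d₀ + 1)) M)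
    (fun B => B.map ((Matrix.toLin' ((B₀ : Matrix (Fin 2) (Fin 2) K) - 1)).restrictScalars 𝒪[K]) ≤ scaleLattice (ϖ ^ d₀) B ∧
      B.map ((Matrix.toLin' ((B₀ : Matrix (Fin 2) (Fin 2) K) - ((B₀ : Matrix (Fin 2) (Fin 2) K).trace / 2) • (1 : Matrix (Fin 2) (Fin 2) K))).restrictScalars 𝒪[K]) ≤
        scaleLattice (ϖ ^ (d₀ + 1)) B) fun g₂ => ?_
  -- the label at an axis frame `latt ι(g₂, 1)`: both tokens move to the `W`-block
  rw [map_endoGL_sub_one_latt_endoGL_le_scaleLattice_iff (pow_ne_zero d₀ hϖ0),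
    forall_centred_mulVec_mem_scaleLattice_latt_endoGL_one_iff (pow_ne_zero (d₀ + 1) hϖ0)]
  exact ⟨fun H => ⟨H.1.1, H.2⟩, fun H => ⟨⟨H.1, hud⟩, H.2⟩⟩

set_option maxHeartbeats 1600000 in -- budget only: statement-heavy lattice tokens.
/-- **THE SHELL KIND OF THE ROOT REGION, CLASS PRESENT, COUNTED ON THE `W`-SIDE.**  Same setting; `t₀ = (ϖ^{d₀})⁻¹·(½tr B₀ − 1)`:
`#{v ∣ v ∈ R ∧ ¬Pin v ∧ Qbig v} = #{B ∣ SD_{Φ₂} B ∧ B₀B = B ∧ ((B₀ − 1)B ≤ ϖ^{d₀}B ∧ ¬(B₀ − cB·1)B ≤ ϖ^{d₀+1}B ∧ CLS^{c,W}_{d₀}(t₀)(B))}` (the boundary shell of the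
`W`-ball, centred class `t₀` present). [cite: Kottwitz1986, §3] [cite: BruhatTits1972, §10] [cite: LabesseLanglands1979, §2 Lemma 2.1 p. 8] [cite: Rogawski1990, §4.9 pp. 54–56] -/
theorem ncard_rootRegion_shell_class_eq_ncard_two [IsPrincipalIdealRing 𝒪[K]] {σ : K →+* K} {ϖ : K}
    (hσ : ∀ a, σ (σ a) = a) (hvσ : ∀ a, Valued.v (σ a) = Valued.v a) (hϖ : Valued.v ϖ = WithZero.exp (-1 : ℤ))
    (γ : unitaryGroupOfForm σ ((StdForm.antidiagonal 3).over K)) (B₀ : GL (Fin 2) K) (hγ : (γ : GL (Fin 3) K) = endoGL (B₀, (1 : GL (Fin 1) K))) {d₀ : ℕ}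
    (hdet : Valued.v ϖ ^ (2 * d₀ + 1) < Valued.v (((B₀ : Matrix (Fin 2) (Fin 2) K) - (1 : Matrix (Fin 2) (Fin 2) K)).det)) :
    {v : {M : Submodule 𝒪[K] (Fin 3 → K) // IsVertex σ ϖ ((StdForm.antidiagonal 3).over K) M} | v ∈ {v : {M : Submodule 𝒪[K] (Fin 3 → K) // IsVertex σ ϖ ((StdForm.antidiagonal 3).over K) M} | latticeGraphIso σ ϖ ((StdForm.antidiagonal 3).over K) γ v = v ∧ IsSelfDualLattice σ ϖ ((StdForm.antidiagonal 3).over K) v.1 ∧ v.1.map ((Matrix.toLin' (((γ : GL (Fin 3) K) : Matrix (Fin 3) (Fin 3) K) - 1)).restrictScalars 𝒪[K]) ≤ scaleLattice (ϖ ^ d₀) v.1} ∧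
        ¬ (∀ y ∈ v.1, y 1 = 0 → ((((γ : GL (Fin 3) K) : Matrix (Fin 3) (Fin 3) K) - ((B₀ : Matrix (Fin 2) (Fin 2) K).trace / 2) • (1 : Matrix (Fin 3) (Fin 3) K)) *ᵥ y) ∈ scaleLattice (ϖ ^ (d₀ + 1)) v.1) ∧
        ∃ y ∈ v.1, y 1 = 0 ∧ ∃ a : K, Valued.v a = 1 ∧ Valued.v ((ϖ ^ d₀)⁻¹ * pairing σ ((StdForm.antidiagonal 3).over K) y ((((γ : GL (Fin 3) K) : Matrix (Fin 3) (Fin 3) K) - ((B₀ : Matrix (Fin 2) (Fin 2) K).trace / 2) • (1 : Matrix (Fin 3) (Fin 3) K)) *ᵥ y) - ((ϖ ^ d₀)⁻¹ * ((B₀ : Matrix (Fin 2) (Fin 2) K).trace / 2 - 1)) * a ^ 2) < 1}.ncard =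
    {B : Submodule 𝒪[K] (Fin 2 → K) | IsSelfDualLattice σ ϖ (!![(0 : K), 1; 1, 0] : Matrix (Fin 2) (Fin 2) K) B ∧ mapGL B₀ B = B ∧
        (B.map ((Matrix.toLin' ((B₀ : Matrix (Fin 2) (Fin 2) K) - 1)).restrictScalars 𝒪[K]) ≤ scaleLattice (ϖ ^ d₀) B ∧
          ¬ B.map ((Matrix.toLin' ((B₀ : Matrix (Fin 2) (Fin 2) K) - ((B₀ : Matrix (Fin 2) (Fin 2) K).trace / 2) • (1 : Matrix (Fin 2) (Fin 2) K))).restrictScalars 𝒪[K]) ≤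
            scaleLattice (ϖ ^ (d₀ + 1)) B ∧
          ∃ y₂ ∈ B, ∃ a : K, Valued.v a = 1 ∧ Valued.v ((ϖ ^ d₀)⁻¹ * pairing σ (!![(0 : K), 1; 1, 0] : Matrix (Fin 2) (Fin 2) K) y₂ ((((B₀ : Matrix (Fin 2) (Fin 2) K)) - ((B₀ : Matrix (Fin 2) (Fin 2) K).trace / 2) • (1 : Matrix (Fin 2) (Fin 2) K)) *ᵥ y₂) - ((ϖ ^ d₀)⁻¹ * ((B₀ : Matrix (Fin 2) (Fin 2) K).trace / 2 - 1)) * a ^ 2) < 1)}.ncard := by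
  have hϖ0' : Valued.v ϖ ≠ 0 := by rw [hϖ]; exact WithZero.exp_ne_zero
  have hϖ0 : ϖ ≠ 0 := fun h0 => by rw [h0, map_zero] at hϖ0'; exact hϖ0' rfl
  have hϖ1 : Valued.v ϖ ≤ 1 := by rw [hϖ, ← WithZero.exp_zero]; exact WithZero.exp_le_exp.2 (by norm_num)
  have hH₂ : IsUnit (!![(0 : K), 1; 1, 0] : Matrix (Fin 2) (Fin 2) K).det := by
    rw [Matrix.det_fin_two]; simp
  have hu : Valued.v (((1 : GL (Fin 1) K) : Matrix (Fin 1) (Fin 1) K) 0 0) = 1 := by rw [Units.val_one, Matrix.one_apply_eq, map_one]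
  have hud : Valued.v (((1 : GL (Fin 1) K) : Matrix (Fin 1) (Fin 1) K) 0 0 - 1) ≤ Valued.v (ϖ ^ d₀) := by
    rw [Units.val_one, Matrix.one_apply_eq, sub_self, map_zero]; exact zero_le
  have hdet' : Valued.v ϖ ^ (2 * d₀ + 1) <
      Valued.v (((B₀ : Matrix (Fin 2) (Fin 2) K) - ((1 : GL (Fin 1) K) : Matrix (Fin 1) (Fin 1) K) 0 0 • (1 : Matrix (Fin 2) (Fin 2) K)).det) := by
    rw [Units.val_one, Matrix.one_apply_eq, one_smul]; exact hdet
  -- the vertex set is the copy of the rank-3 lattice set under `v ↦ v.1`, and every member is an axis vertex (★ THM 4)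
  have himg : (Subtype.val '' {v : {M : Submodule 𝒪[K] (Fin 3 → K) // IsVertex σ ϖ ((StdForm.antidiagonal 3).over K) M} | v ∈ {v : {M : Submodule 𝒪[K] (Fin 3 → K) // IsVertex σ ϖ ((StdForm.antidiagonal 3).over K) M} | latticeGraphIso σ ϖ ((StdForm.antidiagonal 3).over K) γ v = v ∧ IsSelfDualLattice σ ϖ ((StdForm.antidiagonal 3).over K) v.1 ∧ v.1.map ((Matrix.toLin' (((γ : GL (Fin 3) K) : Matrix (Fin 3) (Fin 3) K) - 1)).restrictScalars 𝒪[K]) ≤ scaleLattice (ϖ ^ d₀) v.1} ∧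
        ¬ (∀ y ∈ v.1, y 1 = 0 → ((((γ : GL (Fin 3) K) : Matrix (Fin 3) (Fin 3) K) - ((B₀ : Matrix (Fin 2) (Fin 2) K).trace / 2) • (1 : Matrix (Fin 3) (Fin 3) K)) *ᵥ y) ∈ scaleLattice (ϖ ^ (d₀ + 1)) v.1) ∧
        ∃ y ∈ v.1, y 1 = 0 ∧ ∃ a : K, Valued.v a = 1 ∧ Valued.v ((ϖ ^ d₀)⁻¹ * pairing σ ((StdForm.antidiagonal 3).over K) y ((((γ : GL (Fin 3) K) : Matrix (Fin 3) (Fin 3) K) - ((B₀ : Matrix (Fin 2) (Fin 2) K).trace / 2) • (1 : Matrix (Fin 3) (Fin 3) K)) *ᵥ y) - ((ϖ ^ d₀)⁻¹ * ((B₀ : Matrix (Fin 2) (Fin 2) K).trace / 2 - 1)) * a ^ 2) < 1}) =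
      {M : Submodule 𝒪[K] (Fin 3 → K) | IsSelfDualLattice σ ϖ (!![((!![(0 : K), 1; 1, 0] : Matrix (Fin 2) (Fin 2) K)) 0 0, 0, ((!![(0 : K), 1; 1, 0] : Matrix (Fin 2) (Fin 2) K)) 0 1; 0, (1 : K), 0; ((!![(0 : K), 1; 1, 0] : Matrix (Fin 2) (Fin 2) K)) 1 0, 0, ((!![(0 : K), 1; 1, 0] : Matrix (Fin 2) (Fin 2) K)) 1 1] : Matrix (Fin 3) (Fin 3) K) M ∧
        mapGL (endoGL (B₀, (1 : GL (Fin 1) K))) M = M ∧ (Pi.single 1 1 : Fin 3 → K) ∈ M ∧ (M.map ((Matrix.toLin' (((endoGL (B₀, (1 : GL (Fin 1) K)) : GL (Fin 3) K) : Matrix (Fin 3) (Fin 3) K) - 1)).restrictScalars 𝒪[K]) ≤ scaleLattice (ϖ ^ d₀) M ∧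
          ¬ (∀ y ∈ M, y 1 = 0 → ((((endoGL (B₀, (1 : GL (Fin 1) K)) : GL (Fin 3) K) : Matrix (Fin 3) (Fin 3) K) - ((B₀ : Matrix (Fin 2) (Fin 2) K).trace / 2) • (1 : Matrix (Fin 3) (Fin 3) K)) *ᵥ y) ∈ scaleLattice (ϖ ^ (d₀ + 1)) M) ∧
          ∃ y ∈ M, y 1 = 0 ∧ ∃ a : K, Valued.v a = 1 ∧ Valued.v ((ϖ ^ d₀)⁻¹ * pairing σ ((StdForm.antidiagonal 3).over K) y ((((endoGL (B₀, (1 : GL (Fin 1) K)) : GL (Fin 3) K) : Matrix (Fin 3) (Fin 3) K) - ((B₀ : Matrix (Fin 2) (Fin 2) K).trace / 2) • (1 : Matrix (Fin 3) (Fin 3) K)) *ᵥ y) - ((ϖ ^ d₀)⁻¹ * ((B₀ : Matrix (Fin 2) (Fin 2) K).trace / 2 - 1)) * a ^ 2) < 1)} := by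
    ext M
    simp only [Set.mem_image, Set.mem_setOf_eq]
    constructor
    · rintro ⟨v, ⟨⟨hfix, hSD, hlev⟩, hkind⟩, rfl⟩
      have e := congrArg Subtype.val hfix
      rw [latticeGraphIso_apply_coe, hγ] at e
      have hSD' : IsSelfDualLattice σ ϖ (!![((!![(0 : K), 1; 1, 0] : Matrix (Fin 2) (Fin 2) K)) 0 0, 0, ((!![(0 : K), 1; 1, 0] : Matrix (Fin 2) (Fin 2) K)) 0 1; 0, (1 : K), 0; ((!![(0 : K), 1; 1, 0] : Matrix (Fin 2) (Fin 2) K)) 1 0, 0, ((!![(0 : K), 1; 1, 0] : Matrix (Fin 2) (Fin 2) K)) 1 1] : Matrix (Fin 3) (Fin 3) K) v.1 := by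
        rw [← antidiagonal_three_over_eq_endoShape]; exact hSD
      have hax := single_one_one_mem_of_mem_rootRegion_of_coe_eq_endoGL hσ hvσ hϖ γ B₀ (1 : GL (Fin 1) K) hγ hdet' v ⟨hfix, hSD, hlev⟩
      rw [hγ] at hlev hkind
      exact ⟨hSD', e, hax, hlev, hkind⟩
    · rintro ⟨hSD, hfix, -, hlev, hkind⟩
      rw [← antidiagonal_three_over_eq_endoShape] at hSD
      refine ⟨⟨M, 0, hSD⟩, ⟨⟨?_, hSD, ?_⟩, ?_⟩, rfl⟩
      · apply Subtype.ext
        rw [latticeGraphIso_apply_coe, hγ]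
        exact hfix
      · rw [hγ]; exact hlev
      · rw [hγ]; exact hkind
  rw [← Set.ncard_image_of_injective _ Subtype.val_injective, himg]
  refine ncard_selfDual_fixed_axis_eq σ hvσ hϖ0 hϖ1 hH₂ (h := (1 : K)) (by rw [map_one]) B₀ hu
    (fun M => M.map ((Matrix.toLin' (((endoGL (B₀, (1 : GL (Fin 1) K)) : GL (Fin 3) K) : Matrix (Fin 3) (Fin 3) K) - 1)).restrictScalars 𝒪[K]) ≤ scaleLattice (ϖ ^ d₀) M ∧
      ¬ (∀ y ∈ M, y 1 = 0 → ((((endoGL (B₀, (1 : GL (Fin 1) K)) : GL (Fin 3) K) : Matrix (Fin 3) (Fin 3) K) - ((B₀ : Matrix (Fin 2) (Fin 2) K).trace / 2) • (1 : Matrix (Fin 3) (Fin 3) K)) *ᵥ y) ∈ scaleLattice (ϖ ^ (d₀ + 1)) M) ∧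
      ∃ y ∈ M, y 1 = 0 ∧ ∃ a : K, Valued.v a = 1 ∧ Valued.v ((ϖ ^ d₀)⁻¹ * pairing σ ((StdForm.antidiagonal 3).over K) y ((((endoGL (B₀, (1 : GL (Fin 1) K)) : GL (Fin 3) K) : Matrix (Fin 3) (Fin 3) K) - ((B₀ : Matrix (Fin 2) (Fin 2) K).trace / 2) • (1 : Matrix (Fin 3) (Fin 3) K)) *ᵥ y) - ((ϖ ^ d₀)⁻¹ * ((B₀ : Matrix (Fin 2) (Fin 2) K).trace / 2 - 1)) * a ^ 2) < 1)
    (fun B => B.map ((Matrix.toLin' ((B₀ : Matrix (Fin 2) (Fin 2) K) - 1)).restrictScalars 𝒪[K]) ≤ scaleLattice (ϖ ^ d₀) B ∧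
      ¬ B.map ((Matrix.toLin' ((B₀ : Matrix (Fin 2) (Fin 2) K) - ((B₀ : Matrix (Fin 2) (Fin 2) K).trace / 2) • (1 : Matrix (Fin 2) (Fin 2) K))).restrictScalars 𝒪[K]) ≤
        scaleLattice (ϖ ^ (d₀ + 1)) B ∧
      ∃ y₂ ∈ B, ∃ a : K, Valued.v a = 1 ∧ Valued.v ((ϖ ^ d₀)⁻¹ * pairing σ (!![(0 : K), 1; 1, 0] : Matrix (Fin 2) (Fin 2) K) y₂ ((((B₀ : Matrix (Fin 2) (Fin 2) K)) - ((B₀ : Matrix (Fin 2) (Fin 2) K).trace / 2) • (1 : Matrix (Fin 2) (Fin 2) K)) *ᵥ y₂) - ((ϖ ^ d₀)⁻¹ * ((B₀ : Matrix (Fin 2) (Fin 2) K).trace / 2 - 1)) * a ^ 2) < 1) fun g₂ => ?_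
  -- the label at an axis frame `latt ι(g₂, 1)`: all three tokens move to the `W`-block
  simp only [antidiagonal_three_over_eq_endoShape]
  rw [map_endoGL_sub_one_latt_endoGL_le_scaleLattice_iff (pow_ne_zero d₀ hϖ0),
    forall_centred_mulVec_mem_scaleLattice_latt_endoGL_one_iff (pow_ne_zero (d₀ + 1) hϖ0),
    exists_centred_class_latt_endoGL_one_iff]
  exact ⟨fun H => ⟨H.1.1, H.2⟩, fun H => ⟨⟨H.1, hud⟩, H.2⟩⟩

set_option maxHeartbeats 1600000 in -- budget only: statement-heavy lattice tokens.
/-- **THE SHELL KIND OF THE ROOT REGION, CLASS ABSENT, COUNTED ON THE `W`-SIDE** — the twin of `ncard_rootRegion_shell_class_eq_ncard_two` with `¬Qbig` ∕ `¬CLS^{c,W}` on both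
sides (the three kinds partition the region; FILE 2 evaluates the `W`-side counts in regime B). [cite: Kottwitz1986, §3] [cite: BruhatTits1972, §10]
[cite: LabesseLanglands1979, §2 Lemma 2.1 p. 8] [cite: Rogawski1990, §4.9 pp. 54–56] -/
theorem ncard_rootRegion_shell_not_class_eq_ncard_two [IsPrincipalIdealRing 𝒪[K]] {σ : K →+* K} {ϖ : K}
    (hσ : ∀ a, σ (σ a) = a) (hvσ : ∀ a, Valued.v (σ a) = Valued.v a) (hϖ : Valued.v ϖ = WithZero.exp (-1 : ℤ))
    (γ : unitaryGroupOfForm σ ((StdForm.antidiagonal 3).over K)) (B₀ : GL (Fin 2) K) (hγ : (γ : GL (Fin 3) K) = endoGL (B₀, (1 : GL (Fin 1) K))) {d₀ : ℕ}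
    (hdet : Valued.v ϖ ^ (2 * d₀ + 1) < Valued.v (((B₀ : Matrix (Fin 2) (Fin 2) K) - (1 : Matrix (Fin 2) (Fin 2) K)).det)) :
    {v : {M : Submodule 𝒪[K] (Fin 3 → K) // IsVertex σ ϖ ((StdForm.antidiagonal 3).over K) M} | v ∈ {v : {M : Submodule 𝒪[K] (Fin 3 → K) // IsVertex σ ϖ ((StdForm.antidiagonal 3).over K) M} | latticeGraphIso σ ϖ ((StdForm.antidiagonal 3).over K) γ v = v ∧ IsSelfDualLattice σ ϖ ((StdForm.antidiagonal 3).over K) v.1 ∧ v.1.map ((Matrix.toLin' (((γ : GL (Fin 3) K) : Matrix (Fin 3) (Fin 3) K) - 1)).restrictScalars 𝒪[K]) ≤ scaleLattice (ϖ ^ d₀) v.1} ∧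
        ¬ (∀ y ∈ v.1, y 1 = 0 → ((((γ : GL (Fin 3) K) : Matrix (Fin 3) (Fin 3) K) - ((B₀ : Matrix (Fin 2) (Fin 2) K).trace / 2) • (1 : Matrix (Fin 3) (Fin 3) K)) *ᵥ y) ∈ scaleLattice (ϖ ^ (d₀ + 1)) v.1) ∧
        ¬ (∃ y ∈ v.1, y 1 = 0 ∧ ∃ a : K, Valued.v a = 1 ∧ Valued.v ((ϖ ^ d₀)⁻¹ * pairing σ ((StdForm.antidiagonal 3).over K) y ((((γ : GL (Fin 3) K) : Matrix (Fin 3) (Fin 3) K) - ((B₀ : Matrix (Fin 2) (Fin 2) K).trace / 2) • (1 : Matrix (Fin 3) (Fin 3) K)) *ᵥ y) - ((ϖ ^ d₀)⁻¹ * ((B₀ : Matrix (Fin 2) (Fin 2) K).trace / 2 - 1)) * a ^ 2) < 1)}.ncard =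
    {B : Submodule 𝒪[K] (Fin 2 → K) | IsSelfDualLattice σ ϖ (!![(0 : K), 1; 1, 0] : Matrix (Fin 2) (Fin 2) K) B ∧ mapGL B₀ B = B ∧
        (B.map ((Matrix.toLin' ((B₀ : Matrix (Fin 2) (Fin 2) K) - 1)).restrictScalars 𝒪[K]) ≤ scaleLattice (ϖ ^ d₀) B ∧
          ¬ B.map ((Matrix.toLin' ((B₀ : Matrix (Fin 2) (Fin 2) K) - ((B₀ : Matrix (Fin 2) (Fin 2) K).trace / 2) • (1 : Matrix (Fin 2) (Fin 2) K))).restrictScalars 𝒪[K]) ≤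
            scaleLattice (ϖ ^ (d₀ + 1)) B ∧
          ¬ (∃ y₂ ∈ B, ∃ a : K, Valued.v a = 1 ∧ Valued.v ((ϖ ^ d₀)⁻¹ * pairing σ (!![(0 : K), 1; 1, 0] : Matrix (Fin 2) (Fin 2) K) y₂ ((((B₀ : Matrix (Fin 2) (Fin 2) K)) - ((B₀ : Matrix (Fin 2) (Fin 2) K).trace / 2) • (1 : Matrix (Fin 2) (Fin 2) K)) *ᵥ y₂) - ((ϖ ^ d₀)⁻¹ * ((B₀ : Matrix (Fin 2) (Fin 2) K).trace / 2 - 1)) * a ^ 2) < 1))}.ncard := by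
  have hϖ0' : Valued.v ϖ ≠ 0 := by rw [hϖ]; exact WithZero.exp_ne_zero
  have hϖ0 : ϖ ≠ 0 := fun h0 => by rw [h0, map_zero] at hϖ0'; exact hϖ0' rfl
  have hϖ1 : Valued.v ϖ ≤ 1 := by rw [hϖ, ← WithZero.exp_zero]; exact WithZero.exp_le_exp.2 (by norm_num)
  have hH₂ : IsUnit (!![(0 : K), 1; 1, 0] : Matrix (Fin 2) (Fin 2) K).det := by
    rw [Matrix.det_fin_two]; simp
  have hu : Valued.v (((1 : GL (Fin 1) K) : Matrix (Fin 1) (Fin 1) K) 0 0) = 1 := by rw [Units.val_one, Matrix.one_apply_eq, map_one]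
  have hud : Valued.v (((1 : GL (Fin 1) K) : Matrix (Fin 1) (Fin 1) K) 0 0 - 1) ≤ Valued.v (ϖ ^ d₀) := by
    rw [Units.val_one, Matrix.one_apply_eq, sub_self, map_zero]; exact zero_le
  have hdet' : Valued.v ϖ ^ (2 * d₀ + 1) <
      Valued.v (((B₀ : Matrix (Fin 2) (Fin 2) K) - ((1 : GL (Fin 1) K) : Matrix (Fin 1) (Fin 1) K) 0 0 • (1 : Matrix (Fin 2) (Fin 2) K)).det) := by
    rw [Units.val_one, Matrix.one_apply_eq, one_smul]; exact hdet
  -- the vertex set is the copy of the rank-3 lattice set under `v ↦ v.1`, and every member is an axis vertex (★ THM 4)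
  have himg : (Subtype.val '' {v : {M : Submodule 𝒪[K] (Fin 3 → K) // IsVertex σ ϖ ((StdForm.antidiagonal 3).over K) M} | v ∈ {v : {M : Submodule 𝒪[K] (Fin 3 → K) // IsVertex σ ϖ ((StdForm.antidiagonal 3).over K) M} | latticeGraphIso σ ϖ ((StdForm.antidiagonal 3).over K) γ v = v ∧ IsSelfDualLattice σ ϖ ((StdForm.antidiagonal 3).over K) v.1 ∧ v.1.map ((Matrix.toLin' (((γ : GL (Fin 3) K) : Matrix (Fin 3) (Fin 3) K) - 1)).restrictScalars 𝒪[K]) ≤ scaleLattice (ϖ ^ d₀) v.1} ∧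
        ¬ (∀ y ∈ v.1, y 1 = 0 → ((((γ : GL (Fin 3) K) : Matrix (Fin 3) (Fin 3) K) - ((B₀ : Matrix (Fin 2) (Fin 2) K).trace / 2) • (1 : Matrix (Fin 3) (Fin 3) K)) *ᵥ y) ∈ scaleLattice (ϖ ^ (d₀ + 1)) v.1) ∧
        ¬ (∃ y ∈ v.1, y 1 = 0 ∧ ∃ a : K, Valued.v a = 1 ∧ Valued.v ((ϖ ^ d₀)⁻¹ * pairing σ ((StdForm.antidiagonal 3).over K) y ((((γ : GL (Fin 3) K) : Matrix (Fin 3) (Fin 3) K) - ((B₀ : Matrix (Fin 2) (Fin 2) K).trace / 2) • (1 : Matrix (Fin 3) (Fin 3) K)) *ᵥ y) - ((ϖ ^ d₀)⁻¹ * ((B₀ : Matrix (Fin 2) (Fin 2) K).trace / 2 - 1)) * a ^ 2) < 1)}) =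
      {M : Submodule 𝒪[K] (Fin 3 → K) | IsSelfDualLattice σ ϖ (!![((!![(0 : K), 1; 1, 0] : Matrix (Fin 2) (Fin 2) K)) 0 0, 0, ((!![(0 : K), 1; 1, 0] : Matrix (Fin 2) (Fin 2) K)) 0 1; 0, (1 : K), 0; ((!![(0 : K), 1; 1, 0] : Matrix (Fin 2) (Fin 2) K)) 1 0, 0, ((!![(0 : K), 1; 1, 0] : Matrix (Fin 2) (Fin 2) K)) 1 1] : Matrix (Fin 3) (Fin 3) K) M ∧
        mapGL (endoGL (B₀, (1 : GL (Fin 1) K))) M = M ∧ (Pi.single 1 1 : Fin 3 → K) ∈ M ∧ (M.map ((Matrix.toLin' (((endoGL (B₀, (1 : GL (Fin 1) K)) : GL (Fin 3) K) : Matrix (Fin 3) (Fin 3) K) - 1)).restrictScalars 𝒪[K]) ≤ scaleLattice (ϖ ^ d₀) M ∧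
          ¬ (∀ y ∈ M, y 1 = 0 → ((((endoGL (B₀, (1 : GL (Fin 1) K)) : GL (Fin 3) K) : Matrix (Fin 3) (Fin 3) K) - ((B₀ : Matrix (Fin 2) (Fin 2) K).trace / 2) • (1 : Matrix (Fin 3) (Fin 3) K)) *ᵥ y) ∈ scaleLattice (ϖ ^ (d₀ + 1)) M) ∧
          ¬ (∃ y ∈ M, y 1 = 0 ∧ ∃ a : K, Valued.v a = 1 ∧ Valued.v ((ϖ ^ d₀)⁻¹ * pairing σ ((StdForm.antidiagonal 3).over K) y ((((endoGL (B₀, (1 : GL (Fin 1) K)) : GL (Fin 3) K) : Matrix (Fin 3) (Fin 3) K) - ((B₀ : Matrix (Fin 2) (Fin 2) K).trace / 2) • (1 : Matrix (Fin 3) (Fin 3) K)) *ᵥ y) - ((ϖ ^ d₀)⁻¹ * ((B₀ : Matrix (Fin 2) (Fin 2) K).trace / 2 - 1)) * a ^ 2) < 1))} := by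
    ext M
    simp only [Set.mem_image, Set.mem_setOf_eq]
    constructor
    · rintro ⟨v, ⟨⟨hfix, hSD, hlev⟩, hkind⟩, rfl⟩
      have e := congrArg Subtype.val hfix
      rw [latticeGraphIso_apply_coe, hγ] at e
      have hSD' : IsSelfDualLattice σ ϖ (!![((!![(0 : K), 1; 1, 0] : Matrix (Fin 2) (Fin 2) K)) 0 0, 0, ((!![(0 : K), 1; 1, 0] : Matrix (Fin 2) (Fin 2) K)) 0 1; 0, (1 : K), 0; ((!![(0 : K), 1; 1, 0] : Matrix (Fin 2) (Fin 2) K)) 1 0, 0, ((!![(0 : K), 1; 1, 0] : Matrix (Fin 2) (Fin 2) K)) 1 1] : Matrix (Fin 3) (Fin 3) K) v.1 := by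
        rw [← antidiagonal_three_over_eq_endoShape]; exact hSD
      have hax := single_one_one_mem_of_mem_rootRegion_of_coe_eq_endoGL hσ hvσ hϖ γ B₀ (1 : GL (Fin 1) K) hγ hdet' v ⟨hfix, hSD, hlev⟩
      rw [hγ] at hlev hkind
      exact ⟨hSD', e, hax, hlev, hkind⟩
    · rintro ⟨hSD, hfix, -, hlev, hkind⟩
      rw [← antidiagonal_three_over_eq_endoShape] at hSD
      refine ⟨⟨M, 0, hSD⟩, ⟨⟨?_, hSD, ?_⟩, ?_⟩, rfl⟩
      · apply Subtype.ext
        rw [latticeGraphIso_apply_coe, hγ]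
        exact hfix
      · rw [hγ]; exact hlev
      · rw [hγ]; exact hkind
  rw [← Set.ncard_image_of_injective _ Subtype.val_injective, himg]
  refine ncard_selfDual_fixed_axis_eq σ hvσ hϖ0 hϖ1 hH₂ (h := (1 : K)) (by rw [map_one]) B₀ hu
    (fun M => M.map ((Matrix.toLin' (((endoGL (B₀, (1 : GL (Fin 1) K)) : GL (Fin 3) K) : Matrix (Fin 3) (Fin 3) K) - 1)).restrictScalars 𝒪[K]) ≤ scaleLattice (ϖ ^ d₀) M ∧
      ¬ (∀ y ∈ M, y 1 = 0 → ((((endoGL (B₀, (1 : GL (Fin 1) K)) : GL (Fin 3) K) : Matrix (Fin 3) (Fin 3) K) - ((B₀ : Matrix (Fin 2) (Fin 2) K).trace / 2) • (1 : Matrix (Fin 3) (Fin 3) K)) *ᵥ y) ∈ scaleLattice (ϖ ^ (d₀ + 1)) M) ∧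
      ¬ (∃ y ∈ M, y 1 = 0 ∧ ∃ a : K, Valued.v a = 1 ∧ Valued.v ((ϖ ^ d₀)⁻¹ * pairing σ ((StdForm.antidiagonal 3).over K) y ((((endoGL (B₀, (1 : GL (Fin 1) K)) : GL (Fin 3) K) : Matrix (Fin 3) (Fin 3) K) - ((B₀ : Matrix (Fin 2) (Fin 2) K).trace / 2) • (1 : Matrix (Fin 3) (Fin 3) K)) *ᵥ y) - ((ϖ ^ d₀)⁻¹ * ((B₀ : Matrix (Fin 2) (Fin 2) K).trace / 2 - 1)) * a ^ 2) < 1))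
    (fun B => B.map ((Matrix.toLin' ((B₀ : Matrix (Fin 2) (Fin 2) K) - 1)).restrictScalars 𝒪[K]) ≤ scaleLattice (ϖ ^ d₀) B ∧
      ¬ B.map ((Matrix.toLin' ((B₀ : Matrix (Fin 2) (Fin 2) K) - ((B₀ : Matrix (Fin 2) (Fin 2) K).trace / 2) • (1 : Matrix (Fin 2) (Fin 2) K))).restrictScalars 𝒪[K]) ≤
        scaleLattice (ϖ ^ (d₀ + 1)) B ∧
      ¬ (∃ y₂ ∈ B, ∃ a : K, Valued.v a = 1 ∧ Valued.v ((ϖ ^ d₀)⁻¹ * pairing σ (!![(0 : K), 1; 1, 0] : Matrix (Fin 2) (Fin 2) K) y₂ ((((B₀ : Matrix (Fin 2) (Fin 2) K)) - ((B₀ : Matrix (Fin 2) (Fin 2) K).trace / 2) • (1 : Matrix (Fin 2) (Fin 2) K)) *ᵥ y₂) - ((ϖ ^ d₀)⁻¹ * ((B₀ : Matrix (Fin 2) (Fin 2) K).trace / 2 - 1)) * a ^ 2) < 1)) fun g₂ => ?_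
  -- the label at an axis frame `latt ι(g₂, 1)`: all three tokens move to the `W`-block
  simp only [antidiagonal_three_over_eq_endoShape]
  rw [map_endoGL_sub_one_latt_endoGL_le_scaleLattice_iff (pow_ne_zero d₀ hϖ0),
    forall_centred_mulVec_mem_scaleLattice_latt_endoGL_one_iff (pow_ne_zero (d₀ + 1) hϖ0),
    exists_centred_class_latt_endoGL_one_iff]
  exact ⟨fun H => ⟨H.1.1, H.2⟩, fun H => ⟨⟨H.1, hud⟩, H.2⟩⟩

end Literature.NumberTheory.Automorphic.UnitaryLatticeTree

end
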